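import Summits.HodgeConjecture.HodgeConjecture.Theses.TropicalWeilObstruction
import Summits.HodgeConjecture.HodgeConjecture.Theorems.TropicalWeilObstructionTropicalWeilVanishingBoundaryHyperplane
import Summits.HodgeConjecture.HodgeConjecture.Theorems.TropicalWeilObstructionTropicalWeilVanishingFrameSpanSeeds
import Summits.HodgeConjecture.HodgeConjecture.Theorems.TropicalWeilObstructionTropicalWeilVanishingIntegralityLattice
import HarnessLib

/-!
# Route `TropicalWeilObstruction` (Kontsevich's tropical test — NEGATION SINK, exploration, no summit claim):
# the boundary of the calibration cone — IV. the boundary sub-question `K1_∂` of the crux K1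

Negation-sink bookkeeping of the cell `pub-hodge-tropical` (seat tropical-1 gen 8); part IV of the BOUNDARY series. The landed
class-level analysis of the open crux K1 (`TropicalWeilVanishing`, stmt-HodgeConjecture-18478) ends at theta-degree `8`: integrality
(p345511/p345948) and class positivity (κ = 8, p337681/p343407) prove `W = 0` below degree `8` and nothing beyond, and a degree-`8`
counterexample is CALIBRATED (class `8θ₄ ± Re w`, `8θ₄ ± Im w`, on the cone boundary). This file NAMES the residual statement at
the boundary and makes its readings kernel-exact:

* `TropicalWeilBoundaryVanishing` (`@[conjecture]`, **K1_∂** — an OPEN statement isolated by this cell, NOT in print, implied by K1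
  and not known to imply it): every calibrated (`‖W(Z)‖ = μ(Z)`) effective tropical `4`-cycle on a very general tropical Weil eightfold
  has `W(Z) = 0`;
* `tropicalWeilBoundaryVanishing_of_tropicalWeilVanishing` (K1 ⟹ K1_∂), `tropicalWeilVanishing_iff_boundary_and_interior`
  (K1 ⟺ K1_∂ ∧ interior vanishing);
* equivalent readings: `…_iff_forall_numCells_eq_zero` (calibrated ⟹ empty), `…_iff_boundary` (no effective class on the boundary
  circle but `0`), `…_iff_directionFull` (every non-empty effective cycle's `4`-directions span `⋀⁴ℝ⁸`), `…_iff_not_collinear` (the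
  Gaussian integers `η_σ` of a non-empty effective cycle never lie on one real line), `…_iff_norm_lt` (`W ≠ 0 ⟹ ‖W‖ < μ`);
* `thetaCoord_ge_nine_of_weilFunctional_ne_zero` — under K1_∂ the degree ladder climbs one rung: a counterexample to K1 has `q₀ ≥ 9`;
* `not_tropicalWeilBoundaryVanishing_of_collinear_seed`, `collinear_seed_obstructed` — the certificate format for `¬K1_∂`: a NON-EMPTY
  effective type on `ℝ⁸/ℤ⁸` with collinear determinants, linearly realisable in all of `Sym_J` (transport p341426); dually, under K1_∂
  every such type is obstructed at the identity.

CALIBRATION ACROSS n (prose, the seats' computation, not in the kernel): at `n = 2` the analogue of K1_∂ FAILS — seat b04 g37's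
tropicalised van Geemen cycle has class exactly `4θ₂ ∓ 2w₁` (item evidence `evidence-n2seed-18478-b04-g37.md`), which in the tree's
normalisation is ON the `n = 2` boundary `4q₁² = q₀²`, and its type is unobstructed. HONEST STATUS. K1_∂ is OPEN; everything here is
an implication between open statements or a reformulation; nothing bears on the Hodge conjecture. One `@[conjecture]` definition,
no named fact, no sorry.

References: [Zharkov2020TropicalWeil] I. Zharkov, arXiv:2002.02347, §1–2 (pp. 2–4); [MikhalkinZharkov2014Eigenwave] G. Mikhalkin,
I. Zharkov, LN UMI 15 (2014), Def. 4.2, Prop. 4.3, Thm. 5.4.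
-/

set_option linter.dupNamespace false

noncomputable section

open scoped BigOperators
open Matrix
open Literature.AlgebraicGeometry.Tropical
open Summit.HodgeConjecture.HodgeConjecture.Theorems.TropicalHodgeBound

namespace Summit.HodgeConjecture.HodgeConjecture.Theorems.TropicalWeilVanishing.Boundary

/-! ## §0 Display-only notation (the K3 skeleton's local definitions, verbatim bodies; nothing is defined) -/

/-- `P = [1 | i·1]`, the `n × 2n` matrix of `dz₁ ∧ … ∧ dz_n`. -/
local notation3 (prettyPrint := false) "𝐏⟦" n "⟧" =>
  (Matrix.of fun (k : Fin n) (a : Fin (2 * n)) =>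
    (if (a : ℕ) = (k : ℕ) then (1 : ℂ) else 0) + (if (a : ℕ) = (k : ℕ) + n then Complex.I else 0))

/-- The skeleton's `thetaClass n Q`. -/
local notation3 (prettyPrint := false) "θ⟦" n "⟧" Q:max =>
  (fun S S' : Fin n → Fin (2 * n) => Matrix.det (Matrix.submatrix Q S S'))

/-- The skeleton's `omegaFrame n` (`Ω = Pᴴ`). -/
local notation3 (prettyPrint := false) "Ω⟦" n "⟧" =>
  (Matrix.of fun (a : Fin (2 * n)) (b : Fin n) =>
    (if (a : ℕ) = (b : ℕ) then (1 : ℂ) else 0) - (if (a : ℕ) = (b : ℕ) + n then Complex.I else 0))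

/-- The skeleton's `weilClassC n Q` (`w(Q) = (⋀ⁿQ ⊗ 1)(Ω ⊗ Ω)`). -/
local notation3 (prettyPrint := false) "wC⟦" n "⟧" Q:max =>
  (fun S S' : Fin n → Fin (2 * n) =>
    Matrix.det (Matrix.submatrix (Matrix.map Q ((↑) : ℝ → ℂ) * Ω⟦n⟧) S id) *
      Matrix.det (Matrix.submatrix (Ω⟦n⟧) S' id))

/-- The skeleton's `weilClassRe n Q` (`w₁ = Re w`). -/
local notation3 (prettyPrint := false) "wRe⟦" n "⟧" Q:max =>
  (fun S S' : Fin n → Fin (2 * n) => Complex.re ((wC⟦n⟧ Q) S S'))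

/-- The skeleton's `weilClassIm n Q` (`w₂ = Im w`). -/
local notation3 (prettyPrint := false) "wIm⟦" n "⟧" Q:max =>
  (fun S S' : Fin n → Fin (2 * n) => Complex.im ((wC⟦n⟧ Q) S S'))

/-- The hermitian MASS `μ(Z) = Σ_σ w_σ a_σ |η_σ|²` of an effective tropical `n`-cycle. Nothing is defined. -/
local notation3 (prettyPrint := false) "μ⟦" n "," Z "⟧" =>
  (∑ σ, ((TropicalTorusCycle.cell Z σ).weight : ℝ) * (TropicalTorusCycle.cell Z σ).latticeVolume *
    ‖frameComplexDet n (TropicalTorusCycle.cell Z σ).frame‖ ^ 2)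

variable (Q : Matrix (Fin (2 * 4)) (Fin (2 * 4)) ℝ)

/-! ## §6 The boundary sub-question `K1_∂` of the crux K1, and its kernel-exact readings -/

/-- **K1_∂ `TropicalWeilBoundaryVanishing` — THE BOUNDARY (CALIBRATED) SUB-QUESTION OF THE CRUX K1.** An OPEN statement
ISOLATED BY THIS CELL (`pub-hodge-tropical`, K1-SCOPE §7); it is NOT in print, it is implied by the crux K1
(`Theses.TropicalWeilObstruction.TropicalWeilVanishing`, stmt-HodgeConjecture-18478;
`tropicalWeilBoundaryVanishing_of_tropicalWeilVanishing`) and it is NOT known to imply it. Statement: on the very general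
principally polarised tropical Weil eightfold `ℝ⁸/Qℤ⁸` (`Q ≻ 0`, `QJ = JQ`, `IsWeilGeneric 4 Q`) every CALIBRATED effective
tropical `4`-cycle `Z` — one with EQUALITY `‖W(Z)‖ = μ(Z) = Σ_σ w_σ a_σ |η_σ|²` in the calibration inequality `‖W(Z)‖ ≤ μ(Z)`
(p332805) — has `W(Z) = 0`. Kernel-exact equivalent readings (this file): every calibrated effective cycle is EMPTY
(`…_iff_forall_numCells_eq_zero`); no effective class lies on the boundary circle `64(q₁² + q₂²) = q₀²` of the calibration cone
except `0` (`…_iff_boundary`); every non-empty effective cycle is DIRECTION-FULL — its cells' Plücker vectors span `⋀⁴ℝ⁸`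
(`…_iff_directionFull`); the complex determinants `η_σ ∈ ℤ[i]` of the cells of a non-empty effective cycle never lie on ONE real
line through `0` (`…_iff_not_collinear`); `W(Z) ≠ 0 ⟹ ‖W(Z)‖ < μ(Z)` (`…_iff_norm_lt`). By the degree ladder (rows (I)/(P) of
K1-SCOPE: integrality + class positivity reach exactly theta-degree `< 8`, and a degree-`8` counterexample to K1 is calibrated)
K1_∂ is exactly the first open rung of K1: under K1_∂ a counterexample to K1 has theta-degree `q₀ ≥ 9`
(`thetaCoord_ge_nine_of_weilFunctional_ne_zero`), and `K1 ⟺ K1_∂ ∧ (interior classes have W = 0)`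
(`tropicalWeilVanishing_iff_boundary_and_interior`). CALIBRATION: the `n = 2` analogue of K1_∂ is FALSE — the tropicalised
van Geemen cycle of seat b04 g37 (class `4θ₂ ∓ 2w₁`, `|q₁| = q₀/2`: ON the `n = 2` cone boundary, unobstructed; the seat's
computation, not in print). HONEST STATUS: open; a sub-question of an open problem; nothing here bears on the Hodge conjecture.
[cite: Zharkov2020TropicalWeil, §2 (pp. 2–4)] [cite: MikhalkinZharkov2014Eigenwave, Def. 4.2, Prop. 4.3 and Thm. 5.4] -/
@[conjecture] def TropicalWeilBoundaryVanishing : Prop :=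
  ∀ Q : Matrix (Fin (2 * 4)) (Fin (2 * 4)) ℝ, Q.PosDef → Q * weilJ 4 = weilJ 4 * Q → IsWeilGeneric 4 Q →
    ∀ Z : TropicalTorusCycle (2 * 4) 4 Q,
      ‖weilFunctional Z‖ = ∑ σ, ((Z.cell σ).weight : ℝ) * (Z.cell σ).latticeVolume *
          ‖frameComplexDet 4 (Z.cell σ).frame‖ ^ 2 →
      weilFunctional Z = 0

/-- **K1 ⟹ K1_∂** (trivially: K1 asserts `W(Z) = 0` for every effective `Z`). [cite: Zharkov2020TropicalWeil, §2 (pp. 2–4)] -/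
theorem tropicalWeilBoundaryVanishing_of_tropicalWeilVanishing
    (h : Theses.TropicalWeilObstruction.TropicalWeilVanishing) : TropicalWeilBoundaryVanishing :=
  fun Q hQ hJ hgen Z _ => h Q hQ hJ hgen Z

/-- A calibrated cycle with `W(Z) = 0` at a very general Weil period is EMPTY: `μ(Z) = 0` forces every `η_σ = 0`, but a non-empty
effective cycle has a totally real cell (`FrameSpan.exists_frameComplexDet_ne_zero`, p339280). [cite: Zharkov2020TropicalWeil, §2] -/
theorem numCells_eq_zero_of_calibrated_of_weilFunctional_eq_zero (hQ : Q.PosDef) (hJ : Q * weilJ 4 = weilJ 4 * Q)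
    (hgen : IsWeilGeneric 4 Q) (Z : TropicalTorusCycle (2 * 4) 4 Q) (hcal : ‖weilFunctional Z‖ = μ⟦4, Z⟧)
    (hW : weilFunctional Z = 0) : Z.numCells = 0 := by
  by_contra hne
  obtain ⟨σ, hσ⟩ := FrameSpan.exists_frameComplexDet_ne_zero Q hQ hJ hgen Z (Nat.pos_of_ne_zero hne)
  rw [hW, norm_zero] at hcal
  have hterm := (Finset.sum_eq_zero_iff_of_nonneg fun τ _ =>
    mul_nonneg (mul_nonneg (Nat.cast_nonneg _) (latticeVolume_pos _).le) (sq_nonneg _)).mp hcal.symm σ (Finset.mem_univ σ)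
  have hwa : (0 : ℝ) < ((Z.cell σ).weight : ℝ) * (Z.cell σ).latticeVolume :=
    mul_pos (by exact_mod_cast (Z.cell σ).weight_pos) (latticeVolume_pos _)
  have h2 : ‖frameComplexDet 4 (Z.cell σ).frame‖ ^ 2 = 0 := (mul_eq_zero.mp hterm).resolve_left hwa.ne'
  exact hσ (norm_eq_zero.mp ((pow_eq_zero_iff two_ne_zero).mp h2))

/-- An empty cycle has `W = 0`. [folklore] -/
theorem weilFunctional_eq_zero_of_numCells_eq_zero {n : ℕ} {Q' : Matrix (Fin (2 * n)) (Fin (2 * n)) ℝ}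
    (Z : TropicalTorusCycle (2 * n) n Q') (hZ : Z.numCells = 0) : weilFunctional Z = 0 := by
  unfold weilFunctional
  exact Finset.sum_eq_zero fun σ _ => absurd σ.2 (by omega)

/-- **K1_∂ ⟺ every calibrated effective cycle at a very general Weil period is EMPTY.** [cite: Zharkov2020TropicalWeil, §2 (pp. 2–4)] -/
theorem tropicalWeilBoundaryVanishing_iff_forall_numCells_eq_zero :
    TropicalWeilBoundaryVanishing ↔
      ∀ Q : Matrix (Fin (2 * 4)) (Fin (2 * 4)) ℝ, Q.PosDef → Q * weilJ 4 = weilJ 4 * Q → IsWeilGeneric 4 Q →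
        ∀ Z : TropicalTorusCycle (2 * 4) 4 Q, ‖weilFunctional Z‖ = μ⟦4, Z⟧ → Z.numCells = 0 :=
  ⟨fun h Q hQ hJ hgen Z hcal => numCells_eq_zero_of_calibrated_of_weilFunctional_eq_zero Q hQ hJ hgen Z hcal (h Q hQ hJ hgen Z hcal),
    fun h Q hQ hJ hgen Z hcal => weilFunctional_eq_zero_of_numCells_eq_zero Z (h Q hQ hJ hgen Z hcal)⟩

/-- **K1_∂ ⟺ NO EFFECTIVE CLASS ON THE CONE BOUNDARY except `0`** (class form: for every effective `Z` with
`cyc Z = q₀θ₄(Q) + q₁Re w(Q) + q₂Im w(Q)` and `64(q₁² + q₂²) = q₀²`, `q₁ = q₂ = 0` — hence `q₀ = 0`, `Z` empty). Compare K1 ⟺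
`q₁ = q₂ = 0` for EVERY effective `Z` (`tropicalWeilVanishing_iff_thetaLine`, p329881). [cite: Zharkov2020TropicalWeil, §2 (pp. 2–4)]
[cite: MikhalkinZharkov2014Eigenwave, Prop. 4.3 and Thm. 5.4] -/
theorem tropicalWeilBoundaryVanishing_iff_boundary :
    TropicalWeilBoundaryVanishing ↔
      ∀ Q : Matrix (Fin (2 * 4)) (Fin (2 * 4)) ℝ, Q.PosDef → Q * weilJ 4 = weilJ 4 * Q → IsWeilGeneric 4 Q →
        ∀ (Z : TropicalTorusCycle (2 * 4) 4 Q) (q₀ q₁ q₂ : ℝ),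
          Z.cyc = q₀ • θ⟦4⟧ Q + q₁ • wRe⟦4⟧ Q + q₂ • wIm⟦4⟧ Q → 64 * (q₁ ^ 2 + q₂ ^ 2) = q₀ ^ 2 → q₁ = 0 ∧ q₂ = 0 := by
  constructor
  · intro h Q hQ hJ hgen Z q₀ q₁ q₂ hq hbd
    have hW := h Q hQ hJ hgen Z ((norm_weilFunctional_eq_mass_iff_boundary Q hQ hJ Z hq).mpr hbd)
    rw [weilFunctional_eq_of_repr Q hJ Z hq] at hW
    obtain ⟨hDre, -⟩ := det_frame_mul_map_mul_conjTranspose_pos Q hQ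
    have hD : (𝐏⟦4⟧ * Q.map ((↑) : ℝ → ℂ) * (𝐏⟦4⟧)ᴴ).det ≠ 0 := fun h0 => by
      rw [h0, Complex.zero_re] at hDre; exact lt_irrefl _ hDre
    have h12 : (q₁ : ℂ) - Complex.I * (q₂ : ℂ) = 0 := by
      rcases mul_eq_zero.mp hW with h | h
      · exact absurd ((mul_eq_zero.mp h).resolve_left (by norm_num)) hD
      · exact h
    have e1 := congrArg Complex.re h12
    have e2 := congrArg Complex.im h12
    simp at e1 e2
    exact ⟨e1, by linarith⟩
  · intro h Q hQ hJ hgen Z hcal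
    obtain ⟨q, hq⟩ := stub_rationalHodgeCoordinates Q hQ hJ hgen Z
    have hq' : Z.cyc = (((q 0 : ℚ) : ℝ)) • θ⟦4⟧ Q + (((q 1 : ℚ) : ℝ)) • wRe⟦4⟧ Q + (((q 2 : ℚ) : ℝ)) • wIm⟦4⟧ Q := hq
    obtain ⟨h1, h2⟩ := h Q hQ hJ hgen Z _ _ _ hq' ((norm_weilFunctional_eq_mass_iff_boundary Q hQ hJ Z hq').mp hcal)
    rw [weilFunctional_eq_of_repr Q hJ Z hq', h1, h2]
    simp

/-- **K1_∂ ⟺ DIRECTION-FULLNESS:** every NON-EMPTY effective tropical `4`-cycle at a very general Weil period has restricted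
Plücker vectors spanning `ℝ⁷⁰` — its cells' `4`-directions span all of `⋀⁴ℝ⁸` (frame span `70`, never the `69` of a calibrated
cycle). [cite: Zharkov2020TropicalWeil, §2 (pp. 2–4)] [cite: MikhalkinZharkov2014Eigenwave, Prop. 4.3 and Thm. 5.4] -/
theorem tropicalWeilBoundaryVanishing_iff_directionFull :
    TropicalWeilBoundaryVanishing ↔
      ∀ Q : Matrix (Fin (2 * 4)) (Fin (2 * 4)) ℝ, Q.PosDef → Q * weilJ 4 = weilJ 4 * Q → IsWeilGeneric 4 Q →
        ∀ Z : TropicalTorusCycle (2 * 4) 4 Q, 0 < Z.numCells →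
          Submodule.span ℝ (Set.range fun σ : Fin Z.numCells => fun r : Fin 70 =>
            ((pluckerCoord (Z.cell σ).frame (Chk.wordOfRank r) : ℤ) : ℝ)) = ⊤ := by
  constructor
  · intro h Q hQ hJ hgen Z hZ
    obtain ⟨q, hq, hq0, -⟩ := FrameSpan.exists_coordinates_pos Q hQ hJ hgen Z hZ
    have hq' : Z.cyc = (((q 0 : ℚ) : ℝ)) • θ⟦4⟧ Q + (((q 1 : ℚ) : ℝ)) • wRe⟦4⟧ Q + (((q 2 : ℚ) : ℝ)) • wIm⟦4⟧ Q := hq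
    have hq0' : ((q 0 : ℚ) : ℝ) ≠ 0 := by exact_mod_cast hq0.ne'
    by_cases hbd : 64 * (((q 1 : ℚ) : ℝ) ^ 2 + ((q 2 : ℚ) : ℝ) ^ 2) = ((q 0 : ℚ) : ℝ) ^ 2
    · exfalso
      have hcal := (norm_weilFunctional_eq_mass_iff_boundary Q hQ hJ Z hq').mpr hbd
      have h0 := numCells_eq_zero_of_calibrated_of_weilFunctional_eq_zero Q hQ hJ hgen Z hcal (h Q hQ hJ hgen Z hcal)
      omega
    · exact FrameSpan.span_restrictedFrames_eq_top_of_offBoundary hQ.det_pos.ne'.isUnit hJ Z _ _ _ hq' hq0' hbd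
  · intro h Q hQ hJ hgen Z hcal
    by_cases hZ : Z.numCells = 0
    · exact weilFunctional_eq_zero_of_numCells_eq_zero Z hZ
    · exfalso
      have hZ' : 0 < Z.numCells := Nat.pos_of_ne_zero hZ
      obtain ⟨q, hq, hq0, -⟩ := FrameSpan.exists_coordinates_pos Q hQ hJ hgen Z hZ'
      have hq' : Z.cyc = (((q 0 : ℚ) : ℝ)) • θ⟦4⟧ Q + (((q 1 : ℚ) : ℝ)) • wRe⟦4⟧ Q + (((q 2 : ℚ) : ℝ)) • wIm⟦4⟧ Q := hq
      have hq0' : ((q 0 : ℚ) : ℝ) ≠ 0 := by exact_mod_cast hq0.ne'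
      exact (span_restrictedFrames_eq_top_iff_offBoundary Q hQ hJ Z hq' hq0').mp (h Q hQ hJ hgen Z hZ')
        ((norm_weilFunctional_eq_mass_iff_boundary Q hQ hJ Z hq').mp hcal)

/-- **K1_∂ ⟺ NO COLLINEAR DETERMINANTS:** for every NON-EMPTY effective tropical `4`-cycle at a very general Weil period and every
`ζ ≠ 0` some cell has `Re(ζ η_σ) ≠ 0` — the Gaussian integers `η_σ = det_ℂ L_σ` of the cells never lie on one real line through `0`
(a condition on the FRAMES alone, i.e. on the combinatorial type). [cite: Zharkov2020TropicalWeil, §2 (pp. 2–4)]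
[cite: MikhalkinZharkov2014Eigenwave, Prop. 4.3 and Thm. 5.4] -/
theorem tropicalWeilBoundaryVanishing_iff_not_collinear :
    TropicalWeilBoundaryVanishing ↔
      ∀ Q : Matrix (Fin (2 * 4)) (Fin (2 * 4)) ℝ, Q.PosDef → Q * weilJ 4 = weilJ 4 * Q → IsWeilGeneric 4 Q →
        ∀ Z : TropicalTorusCycle (2 * 4) 4 Q, 0 < Z.numCells →
          ∀ ζ : ℂ, ζ ≠ 0 → ∃ σ, (ζ * frameComplexDet 4 (Z.cell σ).frame).re ≠ 0 := by
  constructor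
  · intro h Q hQ hJ hgen Z hZ ζ hζ
    by_contra hall
    push Not at hall
    have hcal := norm_weilFunctional_eq_mass_of_collinear Z ζ hζ hall
    have h0 := numCells_eq_zero_of_calibrated_of_weilFunctional_eq_zero Q hQ hJ hgen Z hcal (h Q hQ hJ hgen Z hcal)
    omega
  · intro h Q hQ hJ hgen Z hcal
    by_cases hZ : Z.numCells = 0
    · exact weilFunctional_eq_zero_of_numCells_eq_zero Z hZ
    · exfalso
      have hZ' : 0 < Z.numCells := Nat.pos_of_ne_zero hZ
      obtain ⟨q, hq⟩ := stub_rationalHodgeCoordinates Q hQ hJ hgen Z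
      have hq' : Z.cyc = (((q 0 : ℚ) : ℝ)) • θ⟦4⟧ Q + (((q 1 : ℚ) : ℝ)) • wRe⟦4⟧ Q + (((q 2 : ℚ) : ℝ)) • wIm⟦4⟧ Q := hq
      obtain ⟨ζ, hζ, hcol⟩ := exists_collinear_of_boundary Q hQ hJ Z hq'
        ((norm_weilFunctional_eq_mass_iff_boundary Q hQ hJ Z hq').mp hcal)
      obtain ⟨σ, hσ⟩ := h Q hQ hJ hgen Z hZ' ζ hζ
      exact hσ (hcol σ)

/-- **K1_∂ ⟺ STRICT CALIBRATION INEQUALITY FOR COUNTEREXAMPLES:** `W(Z) ≠ 0 ⟹ ‖W(Z)‖ < μ(Z)` at a very general Weil period.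
[cite: Zharkov2020TropicalWeil, §2 (pp. 2–4)] -/
theorem tropicalWeilBoundaryVanishing_iff_norm_lt :
    TropicalWeilBoundaryVanishing ↔
      ∀ Q : Matrix (Fin (2 * 4)) (Fin (2 * 4)) ℝ, Q.PosDef → Q * weilJ 4 = weilJ 4 * Q → IsWeilGeneric 4 Q →
        ∀ Z : TropicalTorusCycle (2 * 4) 4 Q, weilFunctional Z ≠ 0 → ‖weilFunctional Z‖ < μ⟦4, Z⟧ := by
  constructor
  · intro h Q hQ hJ hgen Z hW
    exact lt_of_le_of_ne (norm_weilFunctional_le_weilMass Z) fun hcal => hW (h Q hQ hJ hgen Z hcal)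
  · intro h Q hQ hJ hgen Z hcal
    by_contra hW
    exact absurd hcal (h Q hQ hJ hgen Z hW).ne

/-- **K1 ⟺ K1_∂ ∧ (interior vanishing)** — the crux splits along the cone boundary: calibrated cycles (K1_∂) and cycles with
`‖W‖ < μ`. [cite: Zharkov2020TropicalWeil, §2 (pp. 2–4)] -/
theorem tropicalWeilVanishing_iff_boundary_and_interior :
    Theses.TropicalWeilObstruction.TropicalWeilVanishing ↔
      TropicalWeilBoundaryVanishing ∧
      ∀ Q : Matrix (Fin (2 * 4)) (Fin (2 * 4)) ℝ, Q.PosDef → Q * weilJ 4 = weilJ 4 * Q → IsWeilGeneric 4 Q →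
        ∀ Z : TropicalTorusCycle (2 * 4) 4 Q, ‖weilFunctional Z‖ < μ⟦4, Z⟧ → weilFunctional Z = 0 := by
  refine ⟨fun h => ⟨tropicalWeilBoundaryVanishing_of_tropicalWeilVanishing h, fun Q hQ hJ hgen Z _ => h Q hQ hJ hgen Z⟩,
    fun ⟨hb, hi⟩ Q hQ hJ hgen Z => ?_⟩
  rcases (norm_weilFunctional_le_weilMass Z).lt_or_eq with hlt | heq
  · exact hi Q hQ hJ hgen Z hlt
  · exact hb Q hQ hJ hgen Z heq

/-! ## §7 Under K1_∂ the degree ladder climbs one rung: a counterexample to K1 has theta-degree `≥ 9` -/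

/-- **K1_∂ ⟹ a counterexample to K1 has theta-degree `q₀ ≥ 9` and lies STRICTLY inside the cone.** The class of an effective cycle at a
very general Weil period is an integer lattice point `(a,b,c)` of the calibration cone (`Integrality.latticePoint_int`, p345948); `W ≠ 0`
means `(b,c) ≠ 0`; K1_∂ excludes the boundary, so `64(b² + c²) < a²` with `b² + c² ≥ 1`, i.e. `a ≥ 9`. (Integrality + positivity
alone give `a ≥ 8`, `Integrality.thetaCoord_ge_eight_of_weilFunctional_ne_zero`.) [cite: Zharkov2020TropicalWeil, §2 (pp. 2–4)]
[cite: MikhalkinZharkov2014Eigenwave, Prop. 4.3 and Thm. 5.4] -/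
theorem thetaCoord_ge_nine_of_weilFunctional_ne_zero (hK : TropicalWeilBoundaryVanishing) (hQ : Q.PosDef)
    (hJ : Q * weilJ 4 = weilJ 4 * Q) (hgen : IsWeilGeneric 4 Q) (Z : TropicalTorusCycle (2 * 4) 4 Q) {q₀ q₁ q₂ : ℝ}
    (hq : Z.cyc = q₀ • θ⟦4⟧ Q + q₁ • wRe⟦4⟧ Q + q₂ • wIm⟦4⟧ Q) (hW : weilFunctional Z ≠ 0) :
    9 ≤ q₀ ∧ 64 * (q₁ ^ 2 + q₂ ^ 2) < q₀ ^ 2 := by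
  obtain ⟨a, b, c, habc, ha0, hcone⟩ := Integrality.latticePoint_int Q hQ hJ hgen Z
  obtain ⟨ea, eb, ec⟩ := Ladder.coords_unique Q hQ hJ (hq.symm.trans habc)
  -- not on the boundary
  have hnb : 64 * (b ^ 2 + c ^ 2) ≠ a ^ 2 := by
    intro hbd
    have hbdR : 64 * ((b : ℝ) ^ 2 + (c : ℝ) ^ 2) = (a : ℝ) ^ 2 := by exact_mod_cast hbd
    obtain ⟨hb, hc⟩ := tropicalWeilBoundaryVanishing_iff_boundary.mp hK Q hQ hJ hgen Z _ _ _ habc hbdR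
    apply hW
    rw [weilFunctional_eq_of_repr Q hJ Z habc, hb, hc]
    simp
  -- `(b, c) ≠ 0`
  have hbc : 1 ≤ b ^ 2 + c ^ 2 := by
    by_contra hlt
    push Not at hlt
    have hb : b = 0 := by nlinarith [sq_nonneg b, sq_nonneg c]
    have hc : c = 0 := by nlinarith [sq_nonneg b, sq_nonneg c]
    apply hW
    rw [weilFunctional_eq_of_repr Q hJ Z habc, hb, hc]
    simp
  have hlt : 64 * (b ^ 2 + c ^ 2) < a ^ 2 := lt_of_le_of_ne hcone hnb
  have ha9 : 9 ≤ a := by nlinarith [hlt, hbc, ha0]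
  refine ⟨?_, ?_⟩
  · rw [ea]; exact_mod_cast ha9
  · rw [ea, eb, ec]; exact_mod_cast hlt

/-! ## §8 Seeds: an unobstructed COLLINEAR type at `Q = 1` is exactly what refutes K1_∂ -/

/-- **An UNOBSTRUCTED COLLINEAR SEED REFUTES K1_∂** (certificate format for `¬K1_∂`; compare p330167 for `¬K1`): a NON-EMPTY effective
tropical `4`-cycle `Z₀` on the standard torus `ℝ⁸/ℤ⁸` whose cells' complex determinants are collinear (`Re(ζ η_σ) = 0` for a fixed
`ζ ≠ 0` — a property of the frames, hence of the combinatorial type) and whose type is linearly realisable in every direction of `Sym_J`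
transports (`FrameSpan.exists_generic_realisation_of_linearlyRealisable`, p341426: same frames) to a non-empty calibrated effective cycle
at a very general Weil period. [cite: Zharkov2020TropicalWeil, §1–2 (pp. 2–4)] [cite: MikhalkinZharkov2014Eigenwave, Def. 4.2 and Prop. 4.3] -/
theorem not_tropicalWeilBoundaryVanishing_of_collinear_seed
    (Z₀ : TropicalTorusCycle (2 * 4) 4 (1 : Matrix (Fin (2 * 4)) (Fin (2 * 4)) ℝ)) (hZ₀ : 0 < Z₀.numCells)
    (ζ : ℂ) (hζ : ζ ≠ 0) (hcol : ∀ σ, (ζ * frameComplexDet 4 (Z₀.cell σ).frame).re = 0)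
    (hsec : ∀ D : Matrix (Fin (2 * 4)) (Fin (2 * 4)) ℝ, D.IsSymm → D * weilJ 4 = weilJ 4 * D →
      ∃ (v : Fin Z₀.numCells → Fin (4 + 1) → Fin (2 * 4) → ℝ)
        (T : Fin Z₀.numCells → Matrix (Fin 4) (Fin 4) ℝ)
        (r : Fin Z₀.numFacetClasses → Fin 4 → Fin (2 * 4) → ℝ),
        (∀ (σ : Fin Z₀.numCells) (j : Fin 4) (a : Fin (2 * 4)),
            v σ j.succ a - v σ 0 a = ∑ m, ((Z₀.cell σ).frame a m : ℝ) * T σ m j) ∧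
        (∀ (σ : Fin Z₀.numCells) (i : Fin (4 + 1)) (j : Fin 4) (a : Fin (2 * 4)),
            v σ (i.succAbove (Z₀.facetPerm σ i j)) a =
              r (Z₀.facetClass σ i) j a + ∑ b, D a b * (Z₀.facetShift σ i b : ℝ))) :
    ¬ TropicalWeilBoundaryVanishing := by
  intro hK
  obtain ⟨Q', Z, hQ, hJ, hgen, hc, hframes⟩ := FrameSpan.exists_generic_realisation_of_linearlyRealisable Z₀ hsec
  have hZ : 0 < Z.numCells := by rw [hc]; exact hZ₀
  obtain ⟨σ, hσ⟩ := tropicalWeilBoundaryVanishing_iff_not_collinear.mp hK Q' hQ hJ hgen Z hZ ζ hζ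
  apply hσ
  rw [(hframes σ).1]
  exact hcol _

/-- **Under K1_∂ every non-empty COLLINEAR type on `ℝ⁸/ℤ⁸` is OBSTRUCTED AT THE IDENTITY** (its linearised realisation system is
inconsistent in some direction of `Sym_J`) — a rung of the registered stub `stub_nonflatObstructedAtIdentity` conditional on K1_∂, with
no hypothesis on `W`, flatness or size. [cite: Zharkov2020TropicalWeil, §1–2 (pp. 2–4)] [cite: MikhalkinZharkov2014Eigenwave, Def. 4.2 and Prop. 4.3] -/
theorem collinear_seed_obstructed (hK : TropicalWeilBoundaryVanishing)
    (Z₀ : TropicalTorusCycle (2 * 4) 4 (1 : Matrix (Fin (2 * 4)) (Fin (2 * 4)) ℝ)) (hZ₀ : 0 < Z₀.numCells)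
    (ζ : ℂ) (hζ : ζ ≠ 0) (hcol : ∀ σ, (ζ * frameComplexDet 4 (Z₀.cell σ).frame).re = 0) :
    ¬ ∀ D : Matrix (Fin (2 * 4)) (Fin (2 * 4)) ℝ, D.IsSymm → D * weilJ 4 = weilJ 4 * D →
      ∃ (v : Fin Z₀.numCells → Fin (4 + 1) → Fin (2 * 4) → ℝ)
        (T : Fin Z₀.numCells → Matrix (Fin 4) (Fin 4) ℝ)
        (r : Fin Z₀.numFacetClasses → Fin 4 → Fin (2 * 4) → ℝ),
        (∀ (σ : Fin Z₀.numCells) (j : Fin 4) (a : Fin (2 * 4)),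
            v σ j.succ a - v σ 0 a = ∑ m, ((Z₀.cell σ).frame a m : ℝ) * T σ m j) ∧
        (∀ (σ : Fin Z₀.numCells) (i : Fin (4 + 1)) (j : Fin 4) (a : Fin (2 * 4)),
            v σ (i.succAbove (Z₀.facetPerm σ i j)) a =
              r (Z₀.facetClass σ i) j a + ∑ b, D a b * (Z₀.facetShift σ i b : ℝ)) :=
  fun hsec => not_tropicalWeilBoundaryVanishing_of_collinear_seed Z₀ hZ₀ ζ hζ hcol hsec hK
end Summit.HodgeConjecture.HodgeConjecture.Theorems.TropicalWeilVanishing.Boundary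

end
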